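import Literature.Computability.Cryptography.RegevSamplerMachine
import Literature.Computability.Cryptography.NegligibleEnvelope
import HarnessLib

/-!
# Regev 2009, Lemma 3.14: the slack of the machine bound is negligible in the dimension

Topic `Computability/Cryptography`; sequel of `RegevSamplerMachine.lean` (`slack`, `tvDist_machineCirc_le`) and
`NegligibleEnvelope.lean` (`exists_negligible_envelope`). The machine bound of Lemma 3.14 is
`8·√(weighted failure) + slack n ℓ ℓ_R k k_F Y C η`; this file discharges the parameter choice (blueprint §7): at
input length `m ≥ n` take the rotation precisions `k = 2m+2`, `k_F = 2m+4` (so that `grErr k = qftPhaseErr k_F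
= 9·2^{-m}`, `grErr_two_mul_add_two`, `qftPhaseErr_two_mul_add_four`), register lengths `ℓ, ℓ_R ≤ m^c`, a
rounding error `0 ≤ Y ≤ m^c 2^{-m}`, a table error `0 ≤ η ≤ m^c 2^{-m}` and an outer constant `C ≤ C₀ 2^{-n}`; then

* **`slack_le_slackEnv`** — `slack ≤ slackEnv ν_e C₀ n` for any antitone-type envelope `ν_e` of
  `m^{2c+1} 2^{-m}` over `m ≥ n`;
* `isNegligible_slackEnv` — `slackEnv ν_e C₀` is negligible when `ν_e` is;
* **`exists_negligible_slack_le`** — hence there is ONE negligible `ν` (depending on `c, C₀` only) with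
  `slack n ℓ ℓ_R (2m+2) (2m+4) Y C η ≤ ν n` for all such data and all `m ≥ n ≥ 1`.

Everything is proved; no named fact is introduced.

## References

* O. Regev, *On lattices, learning with errors, random linear codes, and cryptography*, J. ACM 56 (2009), art. 34,
  Lemma 3.14 (proof: "exponentially small error"), §2 (negligible amounts) [Regev2009].
* O. Goldreich, *Foundations of Cryptography* I, CUP 2001, §1.3.3 [Goldreich2001].
-/

noncomputable section

namespace Literature.Computability.Cryptography

namespace Regev2009

namespace SamplerRegs

open Literature.Algebra.EuclideanLattices Literature.Algebra.EuclideanLattices.Regev2009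
  Literature.Computability.QuantumComplexity Literature.Computability.QuantumComplexity.GRWord
  Literature.Computability.QuantumComplexity.QFTWord Filter Asymptotics

open scoped Real

/-! ### The two precision identities -/

/-- `2·(2/2^{2m+2}) = (2^{-m})²`. [folklore] -/
theorem two_mul_two_div_pow (m : ℕ) : (2 : ℝ) * (2 / 2 ^ (2 * m + 2)) = ((2⁻¹ : ℝ) ^ m) ^ 2 := by
  have h : (2 : ℝ) ^ (2 * m + 2) = (2 ^ m) ^ 2 * 4 := by ring
  have h0 : (2 : ℝ) ^ m ≠ 0 := pow_ne_zero _ two_ne_zero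
  rw [h, inv_pow, inv_pow, mul_div_assoc', ← one_div, div_eq_div_iff (by positivity) (by positivity)]
  ring

/-- **`grErr (2m+2) = 9·2^{-m}`.** [cite: Regev2009, Lemma 3.14 (proof)] -/
theorem grErr_two_mul_add_two (m : ℕ) : grErr (2 * m + 2) = 9 * (2⁻¹ : ℝ) ^ m := by
  rw [grErr, two_mul_two_div_pow, Real.sqrt_sq (pow_nonneg (by norm_num) m)]

/-- `2·(8/2^{2m+4}) = (2^{-m})²`. [folklore] -/
theorem two_mul_eight_div_pow (m : ℕ) : (2 : ℝ) * (8 / 2 ^ (2 * m + 4)) = ((2⁻¹ : ℝ) ^ m) ^ 2 := by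
  have h : (2 : ℝ) ^ (2 * m + 4) = (2 ^ m) ^ 2 * 16 := by ring
  have h0 : (2 : ℝ) ^ m ≠ 0 := pow_ne_zero _ two_ne_zero
  rw [h, inv_pow, inv_pow, mul_div_assoc', ← one_div, div_eq_div_iff (by positivity) (by positivity)]
  ring

/-- **`qftPhaseErr (2m+4) = 9·2^{-m}`.** [cite: Regev2009, Lemma 3.14 (proof)] -/
theorem qftPhaseErr_two_mul_add_four (m : ℕ) : qftPhaseErr (2 * m + 4) = 9 * (2⁻¹ : ℝ) ^ m := by
  rw [qftPhaseErr, two_mul_eight_div_pow, Real.sqrt_sq (pow_nonneg (by norm_num) m)]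

/-- `bana^n ≤ 2^{-n}`. [folklore] -/
theorem banaConst_pow_le (n : ℕ) : banaConst ^ n ≤ (2⁻¹ : ℝ) ^ n :=
  pow_le_pow_left₀ banaConst_nonneg (banaConst_le.trans (by norm_num)) n

/-! ### The envelope of the slack -/

/-- **The envelope**: `38 ν_e(n) + 32 C₀ 2^{-n} + 2(√(2(3π ν_e(n) + 2·2^{-n})) + 2·2^{-n}) + 9·2^{-n}`.
[cite: Regev2009, Lemma 3.14 (proof)] -/
def slackEnv (νe : ℕ → ℝ) (C₀ : ℝ) (n : ℕ) : ℝ :=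
  38 * νe n + 32 * (C₀ * (2⁻¹ : ℝ) ^ n) +
    2 * (Real.sqrt (2 * (π * (3 * νe n) + 2 * (2⁻¹ : ℝ) ^ n)) + 2 * (2⁻¹ : ℝ) ^ n) + 9 * (2⁻¹ : ℝ) ^ n

/-- **The envelope is negligible** when `ν_e ≥ 0` is. [cite: Goldreich2001, §1.3.3] -/
theorem isNegligible_slackEnv {νe : ℕ → ℝ} (hν : IsNegligible νe) (hν0 : ∀ n, 0 ≤ νe n) (C₀ : ℝ) :
    IsNegligible (slackEnv νe C₀) := by
  have h2 : IsNegligible fun n : ℕ => (2⁻¹ : ℝ) ^ n := isNegligible_two_inv_pow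
  have hin : IsNegligible fun n : ℕ => 2 * (π * (3 * νe n) + 2 * (2⁻¹ : ℝ) ^ n) :=
    (((hν.const_mul 3).const_mul π).add (h2.const_mul 2)).const_mul 2
  have hsq : IsNegligible fun n : ℕ => Real.sqrt (2 * (π * (3 * νe n) + 2 * (2⁻¹ : ℝ) ^ n)) := by
    have h := isNegligible_sqrt_abs hin
    have heq : (fun n : ℕ => Real.sqrt |2 * (π * (3 * νe n) + 2 * (2⁻¹ : ℝ) ^ n)|) =
        fun n : ℕ => Real.sqrt (2 * (π * (3 * νe n) + 2 * (2⁻¹ : ℝ) ^ n)) := by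
      funext n
      have h0 : 0 ≤ 2 * (π * (3 * νe n) + 2 * (2⁻¹ : ℝ) ^ n) := by
        have := hν0 n; positivity
      rw [abs_of_nonneg h0]
    rw [heq] at h
    exact h
  exact (((hν.const_mul 38).add ((h2.const_mul C₀).const_mul 32)).add ((hsq.add (h2.const_mul 2)).const_mul 2)).add
    (h2.const_mul 9)

/-- **The slack is below the envelope** for the parameter choice `k = 2m+2`, `k_F = 2m+4`, `ℓ, ℓ_R ≤ m^c`,
`0 ≤ Y, η ≤ m^c 2^{-m}`, `C ≤ C₀ 2^{-n}`, whenever `m^{2c+1} 2^{-m} ≤ ν_e(n)`.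
[cite: Regev2009, Lemma 3.14 (proof)] -/
theorem slack_le_slackEnv {c : ℕ} {νe : ℕ → ℝ} {C₀ : ℝ} {n m ℓ ℓR : ℕ} {Y C η : ℝ}
    (hE : ((m : ℕ) : ℝ) ^ (2 * c + 1) * (2⁻¹ : ℝ) ^ m ≤ νe n) (hn : 1 ≤ n) (hnm : n ≤ m)
    (hℓ : ℓ ≤ m ^ c) (hℓR : ℓR ≤ m ^ c) (hY0 : 0 ≤ Y) (hY : Y ≤ (m : ℝ) ^ c * (2⁻¹ : ℝ) ^ m)
    (hη0 : 0 ≤ η) (hη : η ≤ (m : ℝ) ^ c * (2⁻¹ : ℝ) ^ m) (hC : C ≤ C₀ * (2⁻¹ : ℝ) ^ n) :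
    slack n ℓ ℓR (2 * m + 2) (2 * m + 4) Y C η ≤ slackEnv νe C₀ n := by
  set t : ℝ := (2⁻¹ : ℝ) ^ m with ht
  have ht0 : 0 ≤ t := pow_nonneg (by norm_num) m
  have ht1 : t ≤ 1 := pow_le_one₀ (by norm_num) (by norm_num)
  have hm1 : (1 : ℝ) ≤ m := by exact_mod_cast hn.trans hnm
  have hm0 : (0 : ℝ) ≤ m := by positivity
  have hnm' : (n : ℝ) ≤ m := by exact_mod_cast hnm
  have hℓ' : (ℓ : ℝ) ≤ (m : ℝ) ^ c := by exact_mod_cast hℓ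
  have hℓR' : (ℓR : ℝ) ≤ (m : ℝ) ^ c := by exact_mod_cast hℓR
  have hmc0 : 0 ≤ (m : ℝ) ^ c := by positivity
  set E : ℝ := (m : ℝ) ^ (2 * c + 1) * t with hEdef
  have hc1 : (m : ℝ) ^ (c + 1) * t ≤ E := mul_le_mul_of_nonneg_right (pow_le_pow_right₀ hm1 (by omega)) ht0
  have hc2 : (m : ℝ) ^ (2 * c) * t ≤ E := mul_le_mul_of_nonneg_right (pow_le_pow_right₀ hm1 (by omega)) ht0
  have hEν : E ≤ νe n := hE
  -- term 1
  have hT1 : 2 * ((n : ℝ) * (ℓ * (9 * t) + η)) ≤ 20 * νe n := by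
    have h1 : (n : ℝ) * (ℓ * (9 * t) + η) ≤ m * ((m : ℝ) ^ c * (9 * t) + (m : ℝ) ^ c * t) :=
      mul_le_mul hnm' (add_le_add (mul_le_mul_of_nonneg_right hℓ' (by positivity)) hη) (by positivity) hm0
    have h2 : (m : ℝ) * ((m : ℝ) ^ c * (9 * t) + (m : ℝ) ^ c * t) = 10 * ((m : ℝ) ^ (c + 1) * t) := by ring
    linarith
  -- term 2
  have hT2 : 2 * ((n : ℝ) * (ℓR * ℓR * (9 * t))) ≤ 18 * νe n := by
    have h1 : (n : ℝ) * (ℓR * ℓR * (9 * t)) ≤ m * ((m : ℝ) ^ c * (m : ℝ) ^ c * (9 * t)) :=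
      mul_le_mul hnm' (mul_le_mul_of_nonneg_right (mul_le_mul hℓR' hℓR' (by positivity) hmc0) (by positivity))
        (by positivity) hm0
    have h2 : (m : ℝ) * ((m : ℝ) ^ c * (m : ℝ) ^ c * (9 * t)) = 9 * ((m : ℝ) ^ (2 * c) * (m : ℝ) * t) := by ring
    have h3 : (m : ℝ) ^ (2 * c) * (m : ℝ) * t = E := by rw [hEdef, pow_succ]
    linarith
  -- term 3
  have hT3 : 32 * C ≤ 32 * (C₀ * (2⁻¹ : ℝ) ^ n) := by linarith
  -- term 4
  have hsq : Real.sqrt n ≤ m := by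
    rw [Real.sqrt_le_iff]
    exact ⟨hm0, hnm'.trans (by nlinarith)⟩
  have hY1 : 2 * Real.sqrt n * Y ≤ 2 * E := by
    have h1 : 2 * Real.sqrt n * Y ≤ 2 * m * ((m : ℝ) ^ c * t) :=
      mul_le_mul (by linarith) hY hY0 (by positivity)
    have h2 : 2 * (m : ℝ) * ((m : ℝ) ^ c * t) = 2 * ((m : ℝ) ^ (c + 1) * t) := by ring
    linarith
  have hY2 : Y ^ 2 ≤ E := by
    have h1 : Y ^ 2 ≤ ((m : ℝ) ^ c * t) ^ 2 := pow_le_pow_left₀ hY0 hY 2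
    have h2 : ((m : ℝ) ^ c * t) ^ 2 = (m : ℝ) ^ (2 * c) * t * t := by ring
    have h3 : (m : ℝ) ^ (2 * c) * t * t ≤ (m : ℝ) ^ (2 * c) * t := by
      have := mul_le_mul_of_nonneg_left ht1 (mul_nonneg (pow_nonneg hm0 (2 * c)) ht0)
      simpa using this
    linarith
  have h4n : (4⁻¹ : ℝ) ^ n ≤ (2⁻¹ : ℝ) ^ n := pow_le_pow_left₀ (by norm_num) (by norm_num) n
  have hI : π * (2 * Real.sqrt n * Y + Y ^ 2) + banaConst ^ n + (4⁻¹ : ℝ) ^ n ≤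
      π * (3 * νe n) + 2 * (2⁻¹ : ℝ) ^ n := by
    have hπ : π * (2 * Real.sqrt n * Y + Y ^ 2) ≤ π * (3 * νe n) :=
      mul_le_mul_of_nonneg_left (by linarith) Real.pi_pos.le
    linarith [banaConst_pow_le n]
  have hT4 : 2 * Real.sqrt (2 * (π * (2 * Real.sqrt n * Y + Y ^ 2) + banaConst ^ n + (4⁻¹ : ℝ) ^ n)) ≤
      2 * Real.sqrt (2 * (π * (3 * νe n) + 2 * (2⁻¹ : ℝ) ^ n)) :=
    mul_le_mul_of_nonneg_left (Real.sqrt_le_sqrt (by linarith)) zero_le_two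
  -- assemble
  unfold slack slackEnv
  rw [grErr_two_mul_add_two, qftPhaseErr_two_mul_add_four, ← ht]
  linarith

/-- **Regev 2009, Lemma 3.14 (parameters): the slack is negligible in the dimension, uniformly over the input
length.** For every exponent `c` and constant `C₀` there is a negligible `ν` with
`slack n ℓ ℓ_R (2m+2) (2m+4) Y C η ≤ ν(n)` whenever `1 ≤ n ≤ m`, `ℓ, ℓ_R ≤ m^c`, `0 ≤ Y, η ≤ m^c 2^{-m}` and
`C ≤ C₀ 2^{-n}`. [cite: Regev2009, Lemma 3.14 (proof)] -/
theorem exists_negligible_slack_le (c : ℕ) (C₀ : ℝ) :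
    ∃ ν : ℕ → ℝ, IsNegligible ν ∧
      ∀ (n m ℓ ℓR : ℕ) (Y C η : ℝ), 1 ≤ n → n ≤ m → ℓ ≤ m ^ c → ℓR ≤ m ^ c →
        0 ≤ Y → Y ≤ (m : ℝ) ^ c * (2⁻¹ : ℝ) ^ m → 0 ≤ η → η ≤ (m : ℝ) ^ c * (2⁻¹ : ℝ) ^ m →
        C ≤ C₀ * (2⁻¹ : ℝ) ^ n →
          slack n ℓ ℓR (2 * m + 2) (2 * m + 4) Y C η ≤ ν n := by
  obtain ⟨νe, hν, hν0, -, hE⟩ := exists_negligible_envelope (2 * c + 1)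
  exact ⟨slackEnv νe C₀, isNegligible_slackEnv hν hν0 C₀, fun n m ℓ ℓR Y C η hn hnm hℓ hℓR hY0 hY hη0 hη hC =>
    slack_le_slackEnv (hE n m hnm) hn hnm hℓ hℓR hY0 hY hη0 hη hC⟩

end SamplerRegs

end Regev2009

end Literature.Computability.Cryptography

end
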